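import Mathlib.AlgebraicGeometry.Morphisms.Smooth
import Mathlib.AlgebraicGeometry.Geometrically.Irreducible
import Mathlib.AlgebraicGeometry.Noetherian
import Mathlib.AlgebraicGeometry.Properties
import Mathlib.RingTheory.Ideal.KrullsHeightTheorem
import Mathlib.RingTheory.DiscreteValuationRing.Basic
import HarnessLib

/-!
# The generic point of the special fibre of a smooth geometrically irreducible scheme over a DVR

Topic: `Literature/AlgebraicGeometry/Morphisms`. THEOREMS ONLY (no definition, no named fact, no
`sorry`). Cell `hodgecm-mathlib` (D-0151), road W toward the floor binder r₀, leaf **(L1)** of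
B-p18's `W0-SPEC.md` §3 (the (W0) «birational group law on the smooth proper model» line of
B-plan1's `R0-SPEC`): banked generic leaf, no floor change.

Let `R` be a discrete valuation ring with closed point `s`, and `𝒴 → Spec R` smooth and
geometrically irreducible. Then the special fibre `𝒴_s` (the preimage of `s`, a closed subset of
the total space) is irreducible, and its generic point `ξ` satisfies
`dim 𝒪_{𝒴,ξ} ≤ 1` and specialises to every point of `𝒴_s`.

Proof. A smooth morphism is flat and locally of finite presentation, hence (universally) open, and
an open geometrically irreducible morphism has irreducible fibres over points (Mathlib
`Scheme.Hom.isIrreducible_preimage`); the fibre over the closed point is closed, so it has a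
generic point `ξ` (schemes are sober). For the dimension bound pass to an affine open
`Spec B ∋ ξ`: `dim 𝒪_{𝒴,ξ} = coheight ξ = height 𝔭_ξ` (Mathlib `ringKrullDim_stalk_eq_coheight`,
`idealHeight_eq_coheight`), and `𝔭_ξ` is a minimal prime over the principal ideal `ϖB`
(`ϖ` a uniformiser of `R`): a smaller prime containing `ϖ` is a point of the special fibre
generising `ξ`, hence equal to `ξ` by genericity. Krull's principal ideal theorem (Mathlib
`Ideal.height_le_one_of_isPrincipal_of_mem_minimalPrimes`; `B` is noetherian, being of finite type
over the noetherian `R`) gives `height 𝔭_ξ ≤ 1`.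

## References

* S. Bosch, W. Lütkebohmert, M. Raynaud, *Néron Models*, Springer 1990, §2.3 (smoothness, the
  local rings at generic points of the special fibre), §4.3 (Weil's theorem: the set-up «`ζ` a
  generic point of the special fibre `X_k`, `𝒪_{X,ζ}` a discrete valuation ring»).
  [BLRNeronModels1990]
* A. Grothendieck, J. Dieudonné, EGA IV₂ (Publ. Math. IHÉS 24, 1965), Prop. 2.3.4 (open maps and
  generisations), Cor. 6.1.2 (dimension of local rings in a flat family). [GrothendieckDieudonne1965]
-/

noncomputable section

open CategoryTheory CategoryTheory.Limits AlgebraicGeometry Order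

universe u

namespace Literature.AlgebraicGeometry.Morphisms

section SpecialFibre

variable {R : Type u} [CommRing R] [IsLocalRing R] (𝒴 : Over (Spec (.of R)))

/-- The special fibre `𝒴.hom ⁻¹ {s}` (`s` the closed point of the local base) of an open
(e.g. flat and locally finitely presented, e.g. smooth) geometrically irreducible `R`-scheme is an
irreducible closed subset of the total space. [cite: GrothendieckDieudonne1965, Prop. 2.3.4]
[cite: BLRNeronModels1990, §2.3] -/
theorem isIrreducible_preimage_closedPoint [GeometricallyIrreducible 𝒴.hom]
    [UniversallyOpen 𝒴.hom] :
    IsIrreducible (𝒴.hom.base ⁻¹' {IsLocalRing.closedPoint R}) :=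
  𝒴.hom.isIrreducible_preimage 𝒴.hom.isOpenMap isIrreducible_singleton

/-- The special fibre `𝒴.hom ⁻¹ {s}` is closed in the total space. [folklore] -/
private theorem isClosed_preimage_closedPoint :
    IsClosed (𝒴.hom.base ⁻¹' {IsLocalRing.closedPoint R}) :=
  ((PrimeSpectrum.isClosed_singleton_iff_isMaximal _).mpr
    (IsLocalRing.maximalIdeal.isMaximal R)).preimage 𝒴.hom.base.hom.continuous

end SpecialFibre

section DVR

variable {R : Type u} [CommRing R] [IsDomain R] [IsDiscreteValuationRing R]

/-- Over a discrete valuation ring `R` with uniformiser `ϖ`: in an affine open `Spec B` of a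
locally noetherian `R`-scheme `𝒴`, the prime of a point `p` of the special fibre which is
GENERIC in the special fibre of `𝒴` (every point of the special fibre generising it equals it) is a
minimal prime over `ϖB`, hence has height `≤ 1` by Krull's principal ideal theorem. [folklore] -/
private theorem height_le_one_of_generic {𝒴 : Over (Spec (.of R))} {B : CommRingCat.{u}}
    [IsNoetherianRing B] (f : Spec B ⟶ 𝒴.left) [IsOpenImmersion f] (p : Spec B)
    (hp : 𝒴.hom.base (f.base p) = IsLocalRing.closedPoint R)
    (hgen : ∀ y : 𝒴.left, 𝒴.hom.base y = IsLocalRing.closedPoint R → y ⤳ f.base p → y = f.base p) :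
    p.asIdeal.height ≤ 1 := by
  classical
  obtain ⟨φ, hφ⟩ := Spec.map_surjective (f ≫ 𝒴.hom)
  obtain ⟨ϖ, hϖ⟩ := IsDiscreteValuationRing.exists_irreducible R
  have hϖm : IsLocalRing.maximalIdeal R = Ideal.span {ϖ} :=
    (IsDiscreteValuationRing.irreducible_iff_uniformizer ϖ).1 hϖ
  -- the point `q` of `Spec B` lies in the special fibre iff `φ ϖ ∈ q`
  have hfib : ∀ q : Spec B, 𝒴.hom.base (f.base q) = IsLocalRing.closedPoint R ↔
      φ.hom ϖ ∈ q.asIdeal := by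
    intro q
    have e1 : 𝒴.hom.base (f.base q) = (Spec.map φ).base q := by
      rw [hφ]; rfl
    rw [e1]
    change PrimeSpectrum.comap φ.hom q = IsLocalRing.closedPoint R ↔ _
    constructor
    · intro h
      have : ϖ ∈ (PrimeSpectrum.comap φ.hom q).asIdeal := by
        rw [h]; change ϖ ∈ IsLocalRing.maximalIdeal R
        rw [hϖm]; exact Ideal.mem_span_singleton_self ϖ
      exact this
    · intro h
      -- `comap φ q` is a prime of the DVR `R` containing `ϖ ≠ 0`, hence the maximal ideal
      apply PrimeSpectrum.ext
      change Ideal.comap φ.hom q.asIdeal = IsLocalRing.maximalIdeal R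
      have hne : Ideal.comap φ.hom q.asIdeal ≠ ⊥ := fun h0 => by
        have : ϖ ∈ Ideal.comap φ.hom q.asIdeal := h
        rw [h0, Ideal.mem_bot] at this
        exact hϖ.ne_zero this
      have hprime : (Ideal.comap φ.hom q.asIdeal).IsPrime := Ideal.IsPrime.comap φ.hom
      exact IsLocalRing.eq_maximalIdeal (IsPrime.to_maximal_ideal (hpi := hprime) hne)
  -- `p.asIdeal` is a minimal prime over `ϖB`
  have hmin : p.asIdeal ∈ (Ideal.span {φ.hom ϖ}).minimalPrimes := by
    refine ⟨⟨p.isPrime, (Ideal.span_singleton_le_iff_mem _).mpr ((hfib p).1 hp)⟩, ?_⟩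
    rintro q ⟨hq, hϖq⟩ hqp
    let q' : Spec B := ⟨q, hq⟩
    have hq'fib : 𝒴.hom.base (f.base q') = IsLocalRing.closedPoint R :=
      (hfib q').2 ((Ideal.span_singleton_le_iff_mem _).mp hϖq)
    have hspec : f.base q' ⤳ f.base p :=
      ((PrimeSpectrum.le_iff_specializes q' p).mp hqp).map f.base.hom.continuous
    have heq : q' = p := f.isOpenEmbedding.injective (hgen _ hq'fib hspec)
    exact le_of_eq (congrArg PrimeSpectrum.asIdeal heq).symm
  exact Ideal.height_le_one_of_isPrincipal_of_mem_minimalPrimes (Ideal.span {φ.hom ϖ}) _ hmin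

/-- **The generic point of the special fibre.**  Let `R` be a discrete valuation ring and
`𝒴 → Spec R` smooth and geometrically irreducible (no quasi-compactness needed). Then there is a point `ξ` of the total space lying over the closed
point with `dim 𝒪_{𝒴,ξ} ≤ 1` which specialises to EVERY point of the special fibre — the generic
point of the (irreducible, closed) special fibre; its local ring is then a discrete valuation ring
with uniformiser `ϖ` (tree `isDiscreteValuationRing_stalk_of_ringKrullDim_le_one`).
[cite: BLRNeronModels1990, §4.3 (set-up of Weil's theorem) and §2.3]
[cite: GrothendieckDieudonne1965, Cor. 6.1.2] -/
theorem exists_generic_specialFibre (𝒴 : Over (Spec (.of R))) [Smooth 𝒴.hom]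
    [GeometricallyIrreducible 𝒴.hom] :
    ∃ ξ : 𝒴.left, 𝒴.hom.base ξ = IsLocalRing.closedPoint R ∧
      ringKrullDim (𝒴.left.presheaf.stalk ξ) ≤ 1 ∧
      ∀ y : 𝒴.left, 𝒴.hom.base y = IsLocalRing.closedPoint R → ξ ⤳ y := by
  classical
  -- the special fibre, irreducible and closed; its generic point
  have hirr := isIrreducible_preimage_closedPoint 𝒴
  have hcl := isClosed_preimage_closedPoint 𝒴
  set ξ := hirr.genericPoint with hξdef
  have hξ : IsGenericPoint ξ (𝒴.hom.base ⁻¹' {IsLocalRing.closedPoint R}) :=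
    hirr.isGenericPoint_genericPoint hcl
  have hξs : 𝒴.hom.base ξ = IsLocalRing.closedPoint R := hξ.mem
  have hξgen : ∀ y : 𝒴.left, 𝒴.hom.base y = IsLocalRing.closedPoint R → ξ ⤳ y :=
    fun y hy => hξ.specializes hy
  refine ⟨ξ, hξs, ?_, hξgen⟩
  -- locally noetherian total space
  haveI : IsLocallyNoetherian 𝒴.left := LocallyOfFiniteType.isLocallyNoetherian 𝒴.hom
  -- an affine open around `ξ`
  obtain ⟨B, f, hf, hξf, -⟩ :=
    Scheme.exists_affine_mem_range_and_range_subset (U := ⊤) (x := ξ) trivial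
  obtain ⟨p, hp⟩ := hξf
  haveI : IsLocallyNoetherian (Spec B) := isLocallyNoetherian_of_isOpenImmersion f
  haveI : IsNoetherianRing B := isLocallyNoetherian_Spec.mp inferInstance
  -- genericity of `ξ = f p` inside the special fibre, as an equality statement
  have hgen : ∀ y : 𝒴.left, 𝒴.hom.base y = IsLocalRing.closedPoint R → y ⤳ f.base p →
      y = f.base p := by
    intro y hy hyp
    rw [hp]
    exact ((hξgen y hy).antisymm (hp ▸ hyp)).eq.symm
  have hheight : p.asIdeal.height ≤ 1 :=
    height_le_one_of_generic f p (hp ▸ hξs) hgen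
  -- `dim 𝒪_{𝒴,ξ} = coheight ξ = coheight p = height p`
  rw [ringKrullDim_stalk_eq_coheight, ← hp, coheight_eq_of_isOpenImmersion f,
    ← idealHeight_eq_coheight B p]
  exact_mod_cast hheight

end DVR

end Literature.AlgebraicGeometry.Morphisms

end
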